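import Summits.RiemannHypothesis.RiemannHypothesis.Theorems.PfPersistenceRatioModulusIsolation
import Summits.RiemannHypothesis.RiemannHypothesis.Theorems.PfPersistenceGalerkinNegIndex
import HarnessLib

/-!
# PF persistence — the sign-blind RATIO conjuncts force WINDOW INDEX ≤ 1, and the zero-side reading of the
`(Z)`-cell remainder (pub-rhpf barrier-prover, gen 5, leaf G1.21b / §6 PINCER)

**HONEST FRAMING. Mechanism / rigidity campaign; no RH claims.** RH-free, sorry-free, no numerical datum used.

The `(Z)`-cell of §6 PINCER left a typed REMAINDER (RULING A309 (A4)): a class `S ⊆ GaugeRatioClass τ`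
(`|ε₁| ≤ τ(ε₂ − ε₁)` at every window) or `S ⊆ ModulusRatioClass κ` (`|ε₁| ≤ κ|ε₂|`) that separates `ζ` FORCES
`ζ`'s own ∀-window self-ratio bound (`zeta_mem_gaugeRatioClass_of_separates`). This file reads that remainder on
the ZERO side, through the cell's Galerkin negative-index tower (`PfPersistenceGalerkinNegIndex`, cand-3):

* §1 (PROVED, pure 2 × 2 bookkeeping) a sign-blind ratio bound with `τ < 1` (resp. `κ < 1`) at a window forces
  WINDOW INDEX ≤ 1 there: `ε₁ < 0 → 0 < ε₂`, quantitatively `(1 − τ)|ε₁| ≤ τ ε₂` (resp. `|ε₁| ≤ κ ε₂`); hence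
  `0 ≤ ε₂` at every accepted window of dimension ≥ 2;
* §2 (PROVED) REJECTION OF THE INDEX-≥-2 FAILURE CLASS, binder-free: a datum carrying a negative 2-plane at a
  window (`GalerkinNegIndexAtLeast d 2 win`, or an explicit orthogonal pair with form `≤ −m‖·‖²`) lies in NO
  `gaugeRatioAt τ win` (`τ < 1`) and NO `modulusRatioAt κ win` (`κ < 1`) — no hypothesis on `ζ` at all;
* §3 (PROVED) THE ZERO-SIDE READING: `ζ ∈ GaugeRatioClass τ` (`τ < 1`) or `ζ ∈ ModulusRatioClass κ` (`κ < 1`) —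
  in particular any separating class inside them — makes the second Galerkin level non-negative at EVERY window,
  hence (`quadrant_infinite_or_encard_le_one_of_secondRayleigh_nonneg`) the off-line zero quadrant
  `𝒬 = {ρ : ζ(ρ) = 0, Re ρ > 1/2, Im ρ > 0}` is INFINITE or has AT MOST ONE element; contrapositively, if `𝒬` is
  finite with `#𝒬 ≥ 2` then `ζ` itself is REJECTED by every such ∀-window ratio reader. The premise is the cell's
  typed remainder and is NOT asserted; the conclusion is strictly weaker than RH (blind to `#𝒬 = 1`).
-/

set_option linter.dupNamespace false

noncomputable section

open Real Set Matrix
open Literature.NumberTheory.LFunctions.ZetaZeros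

namespace Summit.RiemannHypothesis.RiemannHypothesis.Theorems.PfPersistence

/-! ## §1 Sign-blind ratio bounds force window index ≤ 1 -/

/-- PROVED: under the gauge-ratio bound, a negative bottom is shallow against the second level:
`(1 − τ)|ε₁| ≤ τ ε₂` (division-free; no range hypothesis on `τ`). [folklore] -/
theorem mul_abs_bottom_le_mul_second_of_gaugeRatio {n : ℕ} {M : Matrix (Fin n) (Fin n) ℝ} {τ : ℝ}
    (hacc : |bottomRayleigh M| ≤ τ * (secondRayleigh M - bottomRayleigh M)) (hneg : bottomRayleigh M < 0) :
    (1 - τ) * |bottomRayleigh M| ≤ τ * secondRayleigh M := by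
  rw [abs_of_neg hneg] at hacc ⊢
  nlinarith

/-- **PROVED — GAUGE RATIO ⇒ INDEX ≤ 1**: `|ε₁| ≤ τ(ε₂ − ε₁)` with `0 ≤ τ < 1` and `ε₁ < 0` force `0 < ε₂`.
[folklore] -/
theorem secondRayleigh_pos_of_gaugeRatio {n : ℕ} {M : Matrix (Fin n) (Fin n) ℝ} {τ : ℝ} (hτ0 : 0 ≤ τ)
    (hτ : τ < 1) (hacc : |bottomRayleigh M| ≤ τ * (secondRayleigh M - bottomRayleigh M))
    (hneg : bottomRayleigh M < 0) : 0 < secondRayleigh M := by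
  have h1 := mul_abs_bottom_le_mul_second_of_gaugeRatio hacc hneg
  have h2 : 0 < (1 - τ) * |bottomRayleigh M| := mul_pos (by linarith) (abs_pos.2 hneg.ne)
  by_contra h
  -- `τ ε₂ ≤ 0 < (1 − τ)|ε₁| ≤ τ ε₂`, absurd
  nlinarith [mul_nonneg hτ0 (neg_nonneg.2 (not_lt.1 h))]

/-- PROVED: hence `0 ≤ ε₂` at every window of dimension `≥ 2` satisfying the gauge-ratio bound. [folklore] -/
theorem secondRayleigh_nonneg_of_gaugeRatio {n : ℕ} (hn : 0 < n) {M : Matrix (Fin (n + 1)) (Fin (n + 1)) ℝ}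
    {τ : ℝ} (hτ0 : 0 ≤ τ) (hτ : τ < 1)
    (hacc : |bottomRayleigh M| ≤ τ * (secondRayleigh M - bottomRayleigh M)) : 0 ≤ secondRayleigh M := by
  by_cases hneg : bottomRayleigh M < 0
  · exact (secondRayleigh_pos_of_gaugeRatio hτ0 hτ hacc hneg).le
  · exact (not_lt.1 hneg).trans (bottomRayleigh_le_secondRayleigh hn M)

/-- **PROVED — MODULUS RATIO ⇒ INDEX ≤ 1**: `|ε₁| ≤ κ|ε₂|` with `0 ≤ κ < 1`, `ε₁ < 0` (dimension `≥ 2`) force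
`0 < ε₂`: were `ε₂ ≤ 0`, then `|ε₂| ≤ |ε₁|` (as `ε₁ ≤ ε₂ ≤ 0`) and `|ε₁| ≤ κ|ε₁| < |ε₁|`. [folklore] -/
theorem secondRayleigh_pos_of_modulusRatio {n : ℕ} (hn : 0 < n) {M : Matrix (Fin (n + 1)) (Fin (n + 1)) ℝ}
    {κ : ℝ} (hκ0 : 0 ≤ κ) (hκ : κ < 1) (hacc : |bottomRayleigh M| ≤ κ * |secondRayleigh M|)
    (hneg : bottomRayleigh M < 0) : 0 < secondRayleigh M := by
  by_contra h
  have h2 : secondRayleigh M ≤ 0 := not_lt.1 h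
  have h12 := bottomRayleigh_le_secondRayleigh hn M
  rw [abs_of_neg hneg, abs_of_nonpos h2] at hacc
  nlinarith [mul_nonneg hκ0 (neg_nonneg.2 h2)]

/-- PROVED: under the modulus-ratio bound a negative bottom satisfies `|ε₁| ≤ κ ε₂`. [folklore] -/
theorem abs_bottom_le_mul_second_of_modulusRatio {n : ℕ} (hn : 0 < n)
    {M : Matrix (Fin (n + 1)) (Fin (n + 1)) ℝ} {κ : ℝ} (hκ0 : 0 ≤ κ) (hκ : κ < 1)
    (hacc : |bottomRayleigh M| ≤ κ * |secondRayleigh M|) (hneg : bottomRayleigh M < 0) :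
    |bottomRayleigh M| ≤ κ * secondRayleigh M := by
  rwa [abs_of_pos (secondRayleigh_pos_of_modulusRatio hn hκ0 hκ hacc hneg)] at hacc

/-- PROVED: hence `0 ≤ ε₂` at every window of dimension `≥ 2` satisfying the modulus-ratio bound. [folklore] -/
theorem secondRayleigh_nonneg_of_modulusRatio {n : ℕ} (hn : 0 < n) {M : Matrix (Fin (n + 1)) (Fin (n + 1)) ℝ}
    {κ : ℝ} (hκ0 : 0 ≤ κ) (hκ : κ < 1) (hacc : |bottomRayleigh M| ≤ κ * |secondRayleigh M|) :
    0 ≤ secondRayleigh M := by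
  by_cases hneg : bottomRayleigh M < 0
  · exact (secondRayleigh_pos_of_modulusRatio hn hκ0 hκ hacc hneg).le
  · exact (not_lt.1 hneg).trans (bottomRayleigh_le_secondRayleigh hn M)

/-- PROVED (datum form): a member of `gaugeRatioAt τ win` (`τ < 1`, `0 < win.N`) has `0 ≤ ε₂` at `win`.
[folklore] -/
theorem secondRayleigh_nonneg_of_mem_gaugeRatioAt {d : Datum} {win : Window} (hN : 0 < win.N) {τ : ℝ}
    (hτ0 : 0 ≤ τ) (hτ : τ < 1) (hmem : d ∈ gaugeRatioAt τ win) : 0 ≤ secondRayleigh (d win) :=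
  secondRayleigh_nonneg_of_gaugeRatio hN hτ0 hτ hmem

/-- PROVED (datum form, modulus conjunct). [folklore] -/
theorem secondRayleigh_nonneg_of_mem_modulusRatioAt {d : Datum} {win : Window} (hN : 0 < win.N) {κ : ℝ}
    (hκ0 : 0 ≤ κ) (hκ : κ < 1) (hmem : d ∈ modulusRatioAt κ win) : 0 ≤ secondRayleigh (d win) :=
  secondRayleigh_nonneg_of_modulusRatio hN hκ0 hκ hmem

/-! ## §2 Binder-free rejection of the index-≥-2 failure class -/

/-- **PROVED — A NEGATIVE 2-PLANE IS REJECTED BY EVERY GAUGE-RATIO READER (`τ < 1`)**: an orthogonal pair on whose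
span the window form is `≤ −m‖·‖²` (`m > 0`) puts the datum outside `gaugeRatioAt τ win`; no symmetry, no `ζ`.
[folklore] -/
theorem not_mem_gaugeRatioAt_of_negative_plane {d : Datum} {win : Window} {x y : Fin (win.N + 1) → ℝ}
    (hx : x ≠ 0) (hy : y ≠ 0) (hxy : y ⬝ᵥ x = 0) {m : ℝ} (hm : 0 < m)
    (hB : ∀ α β : ℝ, (α • x + β • y) ⬝ᵥ (d win *ᵥ (α • x + β • y)) ≤ -m * ((α • x + β • y) ⬝ᵥ (α • x + β • y)))
    {τ : ℝ} (hτ0 : 0 ≤ τ) (hτ : τ < 1) : d ∉ gaugeRatioAt τ win := fun hmem =>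
  absurd (secondRayleigh_nonneg_of_mem_gaugeRatioAt (pos_of_orth_pair hx hy hxy) hτ0 hτ hmem)
    (not_le.2 ((secondRayleigh_le_of_plane hx hy hxy hB).trans_lt (by linarith)))

/-- PROVED: the same for every modulus-ratio reader (`κ < 1`). [folklore] -/
theorem not_mem_modulusRatioAt_of_negative_plane {d : Datum} {win : Window} {x y : Fin (win.N + 1) → ℝ}
    (hx : x ≠ 0) (hy : y ≠ 0) (hxy : y ⬝ᵥ x = 0) {m : ℝ} (hm : 0 < m)
    (hB : ∀ α β : ℝ, (α • x + β • y) ⬝ᵥ (d win *ᵥ (α • x + β • y)) ≤ -m * ((α • x + β • y) ⬝ᵥ (α • x + β • y)))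
    {κ : ℝ} (hκ0 : 0 ≤ κ) (hκ : κ < 1) : d ∉ modulusRatioAt κ win := fun hmem =>
  absurd (secondRayleigh_nonneg_of_mem_modulusRatioAt (pos_of_orth_pair hx hy hxy) hκ0 hκ hmem)
    (not_le.2 ((secondRayleigh_le_of_plane hx hy hxy hB).trans_lt (by linarith)))

/-- **PROVED — GALERKIN NEGATIVE INDEX ≥ 2 IS REJECTED** (symmetric block, `0 < win.N`): via
`galerkinNegIndexAtLeast_two_iff_of_isSymm` (`ε₂ < 0`). [folklore] -/
theorem not_mem_gaugeRatioAt_of_galerkinNegIndexAtLeast_two {d : Datum} {win : Window} (hN : 0 < win.N)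
    (hd : (d win).IsSymm) (h2 : GalerkinNegIndexAtLeast d 2 win) {τ : ℝ} (hτ0 : 0 ≤ τ) (hτ : τ < 1) :
    d ∉ gaugeRatioAt τ win := fun hmem =>
  absurd (secondRayleigh_nonneg_of_mem_gaugeRatioAt hN hτ0 hτ hmem)
    (not_le.2 ((galerkinNegIndexAtLeast_two_iff_of_isSymm d win hN hd).1 h2))

/-- PROVED: modulus twin. [folklore] -/
theorem not_mem_modulusRatioAt_of_galerkinNegIndexAtLeast_two {d : Datum} {win : Window} (hN : 0 < win.N)
    (hd : (d win).IsSymm) (h2 : GalerkinNegIndexAtLeast d 2 win) {κ : ℝ} (hκ0 : 0 ≤ κ) (hκ : κ < 1) :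
    d ∉ modulusRatioAt κ win := fun hmem =>
  absurd (secondRayleigh_nonneg_of_mem_modulusRatioAt hN hκ0 hκ hmem)
    (not_le.2 ((galerkinNegIndexAtLeast_two_iff_of_isSymm d win hN hd).1 h2))

/-- PROVED: every member of `dialSpace` with Galerkin negative index `≥ 2` at some window of dimension `≥ 2` lies
outside `GaugeRatioClass τ` for every `τ < 1` (members of `dialSpace` are symmetric window-wise). [folklore] -/
theorem not_mem_gaugeRatioClass_of_galerkinNegIndexAtLeast_two {d : Datum} (hd : d ∈ dialSpace) {win : Window}
    (hN : 0 < win.N) (h2 : GalerkinNegIndexAtLeast d 2 win) {τ : ℝ} (hτ0 : 0 ≤ τ) (hτ : τ < 1) :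
    d ∉ GaugeRatioClass τ := fun hmem =>
  not_mem_gaugeRatioAt_of_galerkinNegIndexAtLeast_two hN (isSymm_of_mem_dialSpace hd win) h2 hτ0 hτ (hmem win)

/-- PROVED: modulus twin. [folklore] -/
theorem not_mem_modulusRatioClass_of_galerkinNegIndexAtLeast_two {d : Datum} (hd : d ∈ dialSpace)
    {win : Window} (hN : 0 < win.N) (h2 : GalerkinNegIndexAtLeast d 2 win) {κ : ℝ} (hκ0 : 0 ≤ κ) (hκ : κ < 1) :
    d ∉ ModulusRatioClass κ := fun hmem =>
  not_mem_modulusRatioAt_of_galerkinNegIndexAtLeast_two hN (isSymm_of_mem_dialSpace hd win) h2 hκ0 hκ (hmem win)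

/-! ## §3 The zero-side reading of the `(Z)`-cell remainder -/

/-- PROVED: `ζ ∈ GaugeRatioClass τ` (`τ < 1`) makes the second Galerkin level non-negative at every window.
[folklore] -/
theorem zeta_secondRayleigh_nonneg_of_mem_gaugeRatioClass {τ : ℝ} (hτ0 : 0 ≤ τ) (hτ : τ < 1)
    (h : zetaDatum ∈ GaugeRatioClass τ) : ∀ win : Window, 0 < win.N → 0 ≤ secondRayleigh (zetaDatum win) :=
  fun win hN => secondRayleigh_nonneg_of_mem_gaugeRatioAt hN hτ0 hτ (h win)

/-- PROVED: modulus twin. [folklore] -/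
theorem zeta_secondRayleigh_nonneg_of_mem_modulusRatioClass {κ : ℝ} (hκ0 : 0 ≤ κ) (hκ : κ < 1)
    (h : zetaDatum ∈ ModulusRatioClass κ) : ∀ win : Window, 0 < win.N → 0 ≤ secondRayleigh (zetaDatum win) :=
  fun win hN => secondRayleigh_nonneg_of_mem_modulusRatioAt hN hκ0 hκ (h win)

/-- **PROVED — THE `(Z)`-CELL REMAINDER READ ON THE ZERO SIDE (gauge)**: if `ζ`'s window data satisfy the
∀-window gauge-ratio bound `|ε₁| ≤ τ(ε₂ − ε₁)` for some `τ < 1`, then the off-line zero quadrant is infinite or has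
at most one element. RH-free; the premise is NOT asserted. [folklore] -/
theorem quadrant_infinite_or_encard_le_one_of_zeta_mem_gaugeRatioClass {τ : ℝ} (hτ0 : 0 ≤ τ) (hτ : τ < 1)
    (h : zetaDatum ∈ GaugeRatioClass τ) :
    {ρ : ℂ | ρ ∈ riemannZetaNontrivialZeros ∧ 1 / 2 < ρ.re ∧ 0 < ρ.im}.Infinite ∨
      {ρ : ℂ | ρ ∈ riemannZetaNontrivialZeros ∧ 1 / 2 < ρ.re ∧ 0 < ρ.im}.encard ≤ 1 :=
  quadrant_infinite_or_encard_le_one_of_secondRayleigh_nonneg (zeta_secondRayleigh_nonneg_of_mem_gaugeRatioClass hτ0 hτ h)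

/-- **PROVED — the same for the modulus conjunct `|ε₁| ≤ κ|ε₂|`, `κ < 1`.** [folklore] -/
theorem quadrant_infinite_or_encard_le_one_of_zeta_mem_modulusRatioClass {κ : ℝ} (hκ0 : 0 ≤ κ) (hκ : κ < 1)
    (h : zetaDatum ∈ ModulusRatioClass κ) :
    {ρ : ℂ | ρ ∈ riemannZetaNontrivialZeros ∧ 1 / 2 < ρ.re ∧ 0 < ρ.im}.Infinite ∨
      {ρ : ℂ | ρ ∈ riemannZetaNontrivialZeros ∧ 1 / 2 < ρ.re ∧ 0 < ρ.im}.encard ≤ 1 :=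
  quadrant_infinite_or_encard_le_one_of_secondRayleigh_nonneg
    (zeta_secondRayleigh_nonneg_of_mem_modulusRatioClass hκ0 hκ h)

/-- PROVED: with finitely many off-line zeros, the gauge remainder leaves at most ONE off-line quadruple.
[folklore] -/
theorem card_le_one_of_zeta_mem_gaugeRatioClass
    (hfin : {ρ : ℂ | ρ ∈ riemannZetaNontrivialZeros ∧ 1 / 2 < ρ.re ∧ 0 < ρ.im}.Finite) {τ : ℝ} (hτ0 : 0 ≤ τ)
    (hτ : τ < 1) (h : zetaDatum ∈ GaugeRatioClass τ) : hfin.toFinset.card ≤ 1 :=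
  card_le_one_of_secondRayleigh_nonneg hfin (zeta_secondRayleigh_nonneg_of_mem_gaugeRatioClass hτ0 hτ h)

/-- PROVED: modulus twin. [folklore] -/
theorem card_le_one_of_zeta_mem_modulusRatioClass
    (hfin : {ρ : ℂ | ρ ∈ riemannZetaNontrivialZeros ∧ 1 / 2 < ρ.re ∧ 0 < ρ.im}.Finite) {κ : ℝ} (hκ0 : 0 ≤ κ)
    (hκ : κ < 1) (h : zetaDatum ∈ ModulusRatioClass κ) : hfin.toFinset.card ≤ 1 :=
  card_le_one_of_secondRayleigh_nonneg hfin (zeta_secondRayleigh_nonneg_of_mem_modulusRatioClass hκ0 hκ h)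

/-- **PROVED — CONTRAPOSITIVE: `2 ≤ #𝒬 < ∞` makes every ∀-window gauge-ratio reader (`τ < 1`) REJECT `ζ`.**
[folklore] -/
theorem zeta_not_mem_gaugeRatioClass_of_two_le_card
    (hfin : {ρ : ℂ | ρ ∈ riemannZetaNontrivialZeros ∧ 1 / 2 < ρ.re ∧ 0 < ρ.im}.Finite)
    (h2 : 2 ≤ hfin.toFinset.card) {τ : ℝ} (hτ0 : 0 ≤ τ) (hτ : τ < 1) : zetaDatum ∉ GaugeRatioClass τ :=
  fun h => absurd (card_le_one_of_zeta_mem_gaugeRatioClass hfin hτ0 hτ h) (by omega)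

/-- PROVED: modulus twin. [folklore] -/
theorem zeta_not_mem_modulusRatioClass_of_two_le_card
    (hfin : {ρ : ℂ | ρ ∈ riemannZetaNontrivialZeros ∧ 1 / 2 < ρ.re ∧ 0 < ρ.im}.Finite)
    (h2 : 2 ≤ hfin.toFinset.card) {κ : ℝ} (hκ0 : 0 ≤ κ) (hκ : κ < 1) : zetaDatum ∉ ModulusRatioClass κ :=
  fun h => absurd (card_le_one_of_zeta_mem_modulusRatioClass hfin hκ0 hκ h) (by omega)

/-- **PROVED — A SEPARATING SIGN-BLIND RATIO CLASS PLACES `ζ`'S ZEROS**: if some `S ⊆ GaugeRatioClass τ`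
(`τ < 1`) separates `ζ` from the detectably negative data of any domain, then `𝒬` is infinite or `#𝒬 ≤ 1`. The
`(Z)`-cell remainder, read on the zero side; RH-free; nothing is asserted about the existence of such an `S`.
[folklore] -/
theorem quadrant_infinite_or_encard_le_one_of_separates_gaugeRatio {S D : Set Datum} {τ : ℝ}
    (hS : S ⊆ GaugeRatioClass τ) (hτ0 : 0 ≤ τ) (hτ : τ < 1) (hsep : Separates S D zetaDatum) :
    {ρ : ℂ | ρ ∈ riemannZetaNontrivialZeros ∧ 1 / 2 < ρ.re ∧ 0 < ρ.im}.Infinite ∨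
      {ρ : ℂ | ρ ∈ riemannZetaNontrivialZeros ∧ 1 / 2 < ρ.re ∧ 0 < ρ.im}.encard ≤ 1 :=
  quadrant_infinite_or_encard_le_one_of_zeta_mem_gaugeRatioClass hτ0 hτ (hS hsep.1)

/-- PROVED: modulus twin. [folklore] -/
theorem quadrant_infinite_or_encard_le_one_of_separates_modulusRatio {S D : Set Datum} {κ : ℝ}
    (hS : S ⊆ ModulusRatioClass κ) (hκ0 : 0 ≤ κ) (hκ : κ < 1) (hsep : Separates S D zetaDatum) :
    {ρ : ℂ | ρ ∈ riemannZetaNontrivialZeros ∧ 1 / 2 < ρ.re ∧ 0 < ρ.im}.Infinite ∨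
      {ρ : ℂ | ρ ∈ riemannZetaNontrivialZeros ∧ 1 / 2 < ρ.re ∧ 0 < ρ.im}.encard ≤ 1 :=
  quadrant_infinite_or_encard_le_one_of_zeta_mem_modulusRatioClass hκ0 hκ (hS hsep.1)

/-- **PROVED — in the world `2 ≤ #𝒬 < ∞` NO class inside a `τ < 1` gauge-ratio class separates `ζ`** from the
negatives of any domain (it does not even contain `ζ`). [folklore] -/
theorem not_separates_of_subset_gaugeRatioClass_of_two_le_card {S D : Set Datum} {τ : ℝ}
    (hS : S ⊆ GaugeRatioClass τ) (hτ0 : 0 ≤ τ) (hτ : τ < 1)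
    (hfin : {ρ : ℂ | ρ ∈ riemannZetaNontrivialZeros ∧ 1 / 2 < ρ.re ∧ 0 < ρ.im}.Finite)
    (h2 : 2 ≤ hfin.toFinset.card) : ¬ Separates S D zetaDatum :=
  fun hsep => zeta_not_mem_gaugeRatioClass_of_two_le_card hfin h2 hτ0 hτ (hS hsep.1)

/-- PROVED: modulus twin. [folklore] -/
theorem not_separates_of_subset_modulusRatioClass_of_two_le_card {S D : Set Datum} {κ : ℝ}
    (hS : S ⊆ ModulusRatioClass κ) (hκ0 : 0 ≤ κ) (hκ : κ < 1)
    (hfin : {ρ : ℂ | ρ ∈ riemannZetaNontrivialZeros ∧ 1 / 2 < ρ.re ∧ 0 < ρ.im}.Finite)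
    (h2 : 2 ≤ hfin.toFinset.card) : ¬ Separates S D zetaDatum :=
  fun hsep => zeta_not_mem_modulusRatioClass_of_two_le_card hfin h2 hκ0 hκ (hS hsep.1)

end Summit.RiemannHypothesis.RiemannHypothesis.Theorems.PfPersistence

end
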